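import Summits.CriticalPhenomena.PercolationContinuityZ3.Theorems.SahiMasterFamilyPointwisePrincipalCapFiveCertA
import Summits.CriticalPhenomena.PercolationContinuityZ3.Theorems.SahiMasterFamilyPointwisePrincipalCapFiveCertB
import Summits.CriticalPhenomena.PercolationContinuityZ3.Theorems.SahiMasterFamilyPointwisePrincipalCapFiveCertC
import Summits.CriticalPhenomena.PercolationContinuityZ3.Theorems.SahiMasterFamilyFaceVanishingPrincipalCap

/-!
# (M⁺-5) on the principal-cap stratum (assembly) — pointwise (EQ-5) for principal-cap, terminal and ALL face-vanishing 5-families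

Unit `prim-master-conj` (crux anchor stmt-CriticalPhenomena-4575, helper work), gen 13.  Assembles the three comb-positive parts of seat P4's order-five
certificate (`combPos_principalCap_cert5a/b/c`) with the top defect `24·μ(⋂U ∖ [c])`:

* `combPos_sahiE5_of_principalCap` / `combPos_sahiE_five_of_principalCap` — **(M⁺-5) on the principal-cap stratum**: five increasing events with
  cylinder common part have `p ↦ E₅(μ_p; 1_U)` comb-positive at multidegree `5` (the identity `E₅ = Σ(76 products) + 24(m_{ABCDE} − P)` is P4's, checked
  by `ring` after the cylinder probabilities are multiplied out);
* `sahiE_five_ind_eq_zero_iff_of_principalCap`, `…_of_terminal` — pointwise (EQ-5) there and on terminal 5-families (`GluedFrames.terminalTight_all 1`);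
* **`sahiE_five_ind_eq_zero_iff_of_faceVanishing` — pointwise (EQ-5) on EVERY face-vanishing 5-family** (absorbing member ⟹ order four,
  `sahiE_four_ind_eq_zero_iff_of_faceVanishing`; `Z₄` deletion ⟹ the step; else principal cap by `GluedFrames.principalCap_of_faceVanishing 1`), with the
  strict form `E₅(μ_p) > 0` off `Z₅`.
So the pointwise master conjecture holds on the face-vanishing class at orders `3, 4, 5`.  Nothing is asserted in general; axioms standard. [this work]
-/

noncomputable section

open scoped Classical

namespace Summit.CriticalPhenomena.PercolationContinuityZ3.Theorems

open Finset Function MeasureTheory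
open Literature.Combinatorics.Sahi2008
open Literature.Probability.LatticeModels (prodBernoulli)
open Literature.Probability.LatticeModels.Kahn2022 (Affects)
open Literature.Probability.Percolation (DeterminedBy)
open Literature.Probability.Percolation.DecisionTree (ind)
open SahiComb

namespace Pointwise

variable {ι : Type} [Fintype ι]

set_option maxHeartbeats 4000000 in
/-- **(M⁺-5) on the principal-cap stratum.**  Five increasing events with cylinder common part `A ∩ B ∩ C ∩ D ∩ E = {T | ↑c ⊆ T}` have
`p ↦ E₅(μ_p; 1_A, …, 1_E)` comb-positive at multidegree `5` (cores disjointified verbatim as in `PrincipalCapC3.sahiE5_nonneg_of_principalCap`). [this work] -/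
theorem combPos_sahiE5_of_principalCap {A B C D E : Set (Set ι)} (hA : IsUpperSet A) (hB : IsUpperSet B) (hC : IsUpperSet C)
    (hD : IsUpperSet D) (hE : IsUpperSet E) (c : Finset ι)
    (hpc : ∀ T : Set ι, (T ∈ A ∧ T ∈ B ∧ T ∈ C ∧ T ∈ D ∧ T ∈ E) ↔ (↑c : Set ι) ⊆ T) :
    CombPos (fun _ : ι => 5) (fun p => sahiE (bernoulliWeight p) 5 ![ind A, ind B, ind C, ind D, ind E]) := by
  -- disjointified cores (verbatim from P4)
  set KA : Finset ι := c.filter fun e => Set.univ \ {e} ∉ A with hKAdef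
  set KB : Finset ι := (c.filter fun e => Set.univ \ {e} ∉ B) \ KA with hKBdef
  set KC : Finset ι := ((c.filter fun e => Set.univ \ {e} ∉ C) \ KA) \ KB with hKCdef
  set KD : Finset ι := (((c.filter fun e => Set.univ \ {e} ∉ D) \ KA) \ KB) \ KC with hKDdef
  set KE : Finset ι := (((c \ KA) \ KB) \ KC) \ KD with hKEdef
  have hcA : ∀ e ∈ KA, Set.univ \ {e} ∉ A := fun e he => (mem_filter.1 he).2
  have hcB : ∀ e ∈ KB, Set.univ \ {e} ∉ B := fun e he => (mem_filter.1 (mem_sdiff.1 he).1).2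
  have hcC : ∀ e ∈ KC, Set.univ \ {e} ∉ C := fun e he => (mem_filter.1 (mem_sdiff.1 (mem_sdiff.1 he).1).1).2
  have hcD : ∀ e ∈ KD, Set.univ \ {e} ∉ D := fun e he =>
    (mem_filter.1 (mem_sdiff.1 (mem_sdiff.1 (mem_sdiff.1 he).1).1).1).2
  have hcE : ∀ e ∈ KE, Set.univ \ {e} ∉ E := by
    intro e he hmem
    have h3 := mem_sdiff.1 he
    have h2 := mem_sdiff.1 h3.1
    have h1 := mem_sdiff.1 h2.1
    have h0 := mem_sdiff.1 h1.1
    have hec : e ∈ c := h0.1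
    have hA' : Set.univ \ {e} ∈ A := by by_contra h; exact h0.2 (mem_filter.2 ⟨hec, h⟩)
    have hB' : Set.univ \ {e} ∈ B := by by_contra h; exact h1.2 (mem_sdiff.2 ⟨mem_filter.2 ⟨hec, h⟩, h0.2⟩)
    have hC' : Set.univ \ {e} ∈ C := by
      by_contra h; exact h2.2 (mem_sdiff.2 ⟨mem_sdiff.2 ⟨mem_filter.2 ⟨hec, h⟩, h0.2⟩, h1.2⟩)
    have hD' : Set.univ \ {e} ∈ D := by
      by_contra h; exact h3.2 (mem_sdiff.2 ⟨mem_sdiff.2 ⟨mem_sdiff.2 ⟨mem_filter.2 ⟨hec, h⟩, h0.2⟩, h1.2⟩, h2.2⟩)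
    have hsub := (hpc _).1 ⟨hA', hB', hC', hD', hmem⟩
    exact (hsub (mem_coe.2 hec)).2 rfl
  have sA : A ⊆ {ω : Set ι | (↑KA : Set ι) ⊆ ω} := PrincipalCapC3.subset_cyl_of_core hA hcA
  have sB : B ⊆ {ω : Set ι | (↑KB : Set ι) ⊆ ω} := PrincipalCapC3.subset_cyl_of_core hB hcB
  have sC : C ⊆ {ω : Set ι | (↑KC : Set ι) ⊆ ω} := PrincipalCapC3.subset_cyl_of_core hC hcC
  have sD : D ⊆ {ω : Set ι | (↑KD : Set ι) ⊆ ω} := PrincipalCapC3.subset_cyl_of_core hD hcD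
  have sE : E ⊆ {ω : Set ι | (↑KE : Set ι) ⊆ ω} := PrincipalCapC3.subset_cyl_of_core hE hcE
  have dAB : Disjoint KA KB := by
    rw [Finset.disjoint_left]; intro e h1 h2; exact (mem_sdiff.1 h2).2 h1
  have dAC : Disjoint KA KC := by
    rw [Finset.disjoint_left]; intro e h1 h2; exact (mem_sdiff.1 (mem_sdiff.1 h2).1).2 h1
  have dAD : Disjoint KA KD := by
    rw [Finset.disjoint_left]; intro e h1 h2; exact (mem_sdiff.1 (mem_sdiff.1 (mem_sdiff.1 h2).1).1).2 h1
  have dAE : Disjoint KA KE := by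
    rw [Finset.disjoint_left]; intro e h1 h2
    exact (mem_sdiff.1 (mem_sdiff.1 (mem_sdiff.1 (mem_sdiff.1 h2).1).1).1).2 h1
  have dBC : Disjoint KB KC := by
    rw [Finset.disjoint_left]; intro e h1 h2; exact (mem_sdiff.1 h2).2 h1
  have dBD : Disjoint KB KD := by
    rw [Finset.disjoint_left]; intro e h1 h2; exact (mem_sdiff.1 (mem_sdiff.1 h2).1).2 h1
  have dBE : Disjoint KB KE := by
    rw [Finset.disjoint_left]; intro e h1 h2; exact (mem_sdiff.1 (mem_sdiff.1 (mem_sdiff.1 h2).1).1).2 h1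
  have dCD : Disjoint KC KD := by
    rw [Finset.disjoint_left]; intro e h1 h2; exact (mem_sdiff.1 h2).2 h1
  have dCE : Disjoint KC KE := by
    rw [Finset.disjoint_left]; intro e h1 h2; exact (mem_sdiff.1 (mem_sdiff.1 h2).1).2 h1
  have dDE : Disjoint KD KE := by
    rw [Finset.disjoint_left]; intro e h1 h2; exact (mem_sdiff.1 h2).2 h1
  have hcov : KA ∪ KB ∪ KC ∪ KD ∪ KE = c := by
    ext e
    simp only [mem_union]
    constructor
    · rintro ((((h | h) | h) | h) | h)
      · exact (mem_filter.1 h).1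
      · exact (mem_filter.1 (mem_sdiff.1 h).1).1
      · exact (mem_filter.1 (mem_sdiff.1 (mem_sdiff.1 h).1).1).1
      · exact (mem_filter.1 (mem_sdiff.1 (mem_sdiff.1 (mem_sdiff.1 h).1).1).1).1
      · exact (mem_sdiff.1 (mem_sdiff.1 (mem_sdiff.1 (mem_sdiff.1 h).1).1).1).1
    · intro hec
      by_cases h1 : e ∈ KA
      · exact Or.inl (Or.inl (Or.inl (Or.inl h1)))
      · by_cases h2 : e ∈ KB
        · exact Or.inl (Or.inl (Or.inl (Or.inr h2)))
        · by_cases h3 : e ∈ KC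
          · exact Or.inl (Or.inl (Or.inr h3))
          · by_cases h4 : e ∈ KD
            · exact Or.inl (Or.inr h4)
            · exact Or.inr (mem_sdiff.2 ⟨mem_sdiff.2 ⟨mem_sdiff.2 ⟨mem_sdiff.2 ⟨hec, h1⟩, h2⟩, h3⟩, h4⟩)
  have hcABCDE : {ω : Set ι | (↑c : Set ι) ⊆ ω} ⊆ A ∩ B ∩ C ∩ D ∩ E := by
    intro ω hω
    obtain ⟨h1, h2, h3, h4, h5⟩ := (hpc ω).2 hω
    exact ⟨⟨⟨⟨h1, h2⟩, h3⟩, h4⟩, h5⟩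
  have d15 : (fun _ : ι => (1 : ℕ)) ≤ (fun _ : ι => 5) := fun e => by norm_num
  have T77 : CombPos (fun _ : ι => 5) (fun p =>
      24 * (ex (bernoulliWeight p) (ind (A ∩ B ∩ C ∩ D ∩ E)) - ex (bernoulliWeight p) (ind {ω : Set ι | (↑c : Set ι) ⊆ ω}))) :=
    ((SahiCombDomination.combPos_ex_sub_of_subset hcABCDE).smul (by norm_num : (0:ℝ) ≤ 24)).mono d15
  have hsum := (((combPos_principalCap_cert5a hD hE sA sB sC sD sE).add (combPos_principalCap_cert5b hA hB hC hD sA sB sC sD sE)).add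
    (combPos_principalCap_cert5c hA hB hC hE sA sB sC sD sE)).add T77
  refine hsum.congr fun p => ?_
  -- the identity at `p`
  set PA : ℝ := ∏ e ∈ KA, (p e : ℝ) with hPAdef
  set PB : ℝ := ∏ e ∈ KB, (p e : ℝ) with hPBdef
  set PC : ℝ := ∏ e ∈ KC, (p e : ℝ) with hPCdef
  set PD : ℝ := ∏ e ∈ KD, (p e : ℝ) with hPDdef
  set PE : ℝ := ∏ e ∈ KE, (p e : ℝ) with hPEdef
  have qAB : ∏ e ∈ KA ∪ KB, (p e : ℝ) = PA * PB := by
    rw [prod_union dAB]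
  have qAC : ∏ e ∈ KA ∪ KC, (p e : ℝ) = PA * PC := by
    rw [prod_union dAC]
  have qAD : ∏ e ∈ KA ∪ KD, (p e : ℝ) = PA * PD := by
    rw [prod_union dAD]
  have qAE : ∏ e ∈ KA ∪ KE, (p e : ℝ) = PA * PE := by
    rw [prod_union dAE]
  have qBC : ∏ e ∈ KB ∪ KC, (p e : ℝ) = PB * PC := by
    rw [prod_union dBC]
  have qBD : ∏ e ∈ KB ∪ KD, (p e : ℝ) = PB * PD := by
    rw [prod_union dBD]
  have qBE : ∏ e ∈ KB ∪ KE, (p e : ℝ) = PB * PE := by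
    rw [prod_union dBE]
  have qCD : ∏ e ∈ KC ∪ KD, (p e : ℝ) = PC * PD := by
    rw [prod_union dCD]
  have qCE : ∏ e ∈ KC ∪ KE, (p e : ℝ) = PC * PE := by
    rw [prod_union dCE]
  have qDE : ∏ e ∈ KD ∪ KE, (p e : ℝ) = PD * PE := by
    rw [prod_union dDE]
  have qABC : ∏ e ∈ KA ∪ KB ∪ KC, (p e : ℝ) = PA * PB * PC := by
    rw [prod_union (disjoint_union_left.2 ⟨dAC, dBC⟩), prod_union dAB]
  have qABD : ∏ e ∈ KA ∪ KB ∪ KD, (p e : ℝ) = PA * PB * PD := by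
    rw [prod_union (disjoint_union_left.2 ⟨dAD, dBD⟩), prod_union dAB]
  have qABE : ∏ e ∈ KA ∪ KB ∪ KE, (p e : ℝ) = PA * PB * PE := by
    rw [prod_union (disjoint_union_left.2 ⟨dAE, dBE⟩), prod_union dAB]
  have qACD : ∏ e ∈ KA ∪ KC ∪ KD, (p e : ℝ) = PA * PC * PD := by
    rw [prod_union (disjoint_union_left.2 ⟨dAD, dCD⟩), prod_union dAC]
  have qACE : ∏ e ∈ KA ∪ KC ∪ KE, (p e : ℝ) = PA * PC * PE := by
    rw [prod_union (disjoint_union_left.2 ⟨dAE, dCE⟩), prod_union dAC]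
  have qADE : ∏ e ∈ KA ∪ KD ∪ KE, (p e : ℝ) = PA * PD * PE := by
    rw [prod_union (disjoint_union_left.2 ⟨dAE, dDE⟩), prod_union dAD]
  have qBCD : ∏ e ∈ KB ∪ KC ∪ KD, (p e : ℝ) = PB * PC * PD := by
    rw [prod_union (disjoint_union_left.2 ⟨dBD, dCD⟩), prod_union dBC]
  have qBCE : ∏ e ∈ KB ∪ KC ∪ KE, (p e : ℝ) = PB * PC * PE := by
    rw [prod_union (disjoint_union_left.2 ⟨dBE, dCE⟩), prod_union dBC]
  have qBDE : ∏ e ∈ KB ∪ KD ∪ KE, (p e : ℝ) = PB * PD * PE := by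
    rw [prod_union (disjoint_union_left.2 ⟨dBE, dDE⟩), prod_union dBD]
  have qCDE : ∏ e ∈ KC ∪ KD ∪ KE, (p e : ℝ) = PC * PD * PE := by
    rw [prod_union (disjoint_union_left.2 ⟨dCE, dDE⟩), prod_union dCD]
  have qABCD : ∏ e ∈ KA ∪ KB ∪ KC ∪ KD, (p e : ℝ) = PA * PB * PC * PD := by
    rw [prod_union (disjoint_union_left.2 ⟨(disjoint_union_left.2 ⟨dAD, dBD⟩), dCD⟩), prod_union (disjoint_union_left.2 ⟨dAC, dBC⟩), prod_union dAB]
  have qABCE : ∏ e ∈ KA ∪ KB ∪ KC ∪ KE, (p e : ℝ) = PA * PB * PC * PE := by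
    rw [prod_union (disjoint_union_left.2 ⟨(disjoint_union_left.2 ⟨dAE, dBE⟩), dCE⟩), prod_union (disjoint_union_left.2 ⟨dAC, dBC⟩), prod_union dAB]
  have qABDE : ∏ e ∈ KA ∪ KB ∪ KD ∪ KE, (p e : ℝ) = PA * PB * PD * PE := by
    rw [prod_union (disjoint_union_left.2 ⟨(disjoint_union_left.2 ⟨dAE, dBE⟩), dDE⟩), prod_union (disjoint_union_left.2 ⟨dAD, dBD⟩), prod_union dAB]
  have qACDE : ∏ e ∈ KA ∪ KC ∪ KD ∪ KE, (p e : ℝ) = PA * PC * PD * PE := by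
    rw [prod_union (disjoint_union_left.2 ⟨(disjoint_union_left.2 ⟨dAE, dCE⟩), dDE⟩), prod_union (disjoint_union_left.2 ⟨dAD, dCD⟩), prod_union dAC]
  have qBCDE : ∏ e ∈ KB ∪ KC ∪ KD ∪ KE, (p e : ℝ) = PB * PC * PD * PE := by
    rw [prod_union (disjoint_union_left.2 ⟨(disjoint_union_left.2 ⟨dBE, dCE⟩), dDE⟩), prod_union (disjoint_union_left.2 ⟨dBD, dCD⟩), prod_union dBC]
  have qABCDE : ∏ e ∈ KA ∪ KB ∪ KC ∪ KD ∪ KE, (p e : ℝ) = PA * PB * PC * PD * PE := by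
    rw [prod_union (disjoint_union_left.2 ⟨(disjoint_union_left.2 ⟨(disjoint_union_left.2 ⟨dAE, dBE⟩), dCE⟩), dDE⟩), prod_union (disjoint_union_left.2 ⟨(disjoint_union_left.2 ⟨dAD, dBD⟩), dCD⟩), prod_union (disjoint_union_left.2 ⟨dAC, dBC⟩), prod_union dAB]
  have hPc : (prodBernoulli p).real {ω : Set ι | (↑c : Set ι) ⊆ ω} = PA * PB * PC * PD * PE := by
    rw [← hcov, PrincipalCapC3.real_cyl, qABCDE]
  rw [sahiE_five]
  simp only [ind_mul_ind_eq_inter, ex_bernoulliWeight_ind, covFun]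
  rw [hPc]
  simp only [PrincipalCapC3.real_cyl]
  simp only [qAB, qAC, qAD, qAE, qBC, qBD, qBE, qCD, qCE, qDE, qABC, qABD, qABE, qACD, qACE, qADE, qBCD, qBCE, qBDE, qCDE, qABCD, qABCE, qABDE, qACDE, qBCDE]
  ring

/-- The same for a `Fin 5`-family (`fun j => ind (U j)`). [this work] -/
theorem combPos_sahiE_five_of_principalCap (U : Fin 5 → Set (Set ι)) (hU : ∀ j, IsUpperSet (U j)) (c : Finset ι)
    (hpc : ∀ T : Set ι, (∀ j, T ∈ U j) ↔ (↑c : Set ι) ⊆ T) :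
    CombPos (fun _ : ι => 5) (fun p => sahiE (bernoulliWeight p) 5 (fun j => ind (U j))) := by
  have e : (fun j => ind (U j)) = ![ind (U 0), ind (U 1), ind (U 2), ind (U 3), ind (U 4)] := by
    funext j; fin_cases j <;> rfl
  have hpc' : ∀ T : Set ι, (T ∈ U 0 ∧ T ∈ U 1 ∧ T ∈ U 2 ∧ T ∈ U 3 ∧ T ∈ U 4) ↔ (↑c : Set ι) ⊆ T := by
    intro T
    rw [← hpc T]
    constructor
    · rintro ⟨h0, h1, h2, h3, h4⟩ j
      fin_cases j
      · exact h0
      · exact h1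
      · exact h2
      · exact h3
      · exact h4
    · intro h; exact ⟨h 0, h 1, h 2, h 3, h 4⟩
  exact (combPos_sahiE5_of_principalCap (hU 0) (hU 1) (hU 2) (hU 3) (hU 4) c hpc').congr fun p => by rw [e]

/-- **Pointwise (EQ-5) on the principal-cap stratum**: at every interior `p`, `E₅(μ_p; 1_U) = 0 ↔ U ∈ Z₅`. [this work] -/
theorem sahiE_five_ind_eq_zero_iff_of_principalCap (p : ι → unitInterval) (hp : ∀ e, (p e : ℝ) ∈ Set.Ioo (0 : ℝ) 1)
    (U : Fin 5 → Set (Set ι)) (hU : ∀ j, IsUpperSet (U j)) (c : Finset ι)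
    (hpc : ∀ T : Set ι, (∀ j, T ∈ U j) ↔ (↑c : Set ι) ⊆ T) :
    sahiE (bernoulliWeight p) 5 (fun j => ind (U j)) = 0 ↔ SuppZeroFlag 5 U :=
  sahiE_ind_eq_zero_iff_of_combPos hU (combPos_sahiE_five_of_principalCap U hU c hpc) hp

/-- **(M⁺-5) on face-vanishing 5-families without absorbing member and without `Z₄` deletion** (principal cap by
`GluedFrames.principalCap_of_faceVanishing 1`). [this work] -/
theorem combPos_sahiE_five_of_faceVanishing_noAbsorber (U : Fin 5 → Set (Set ι)) (S : Finset ι) (hU : ∀ j, IsUpperSet (U j))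
    (hUS : ∀ j, DeterminedBy (U j) (↑S : Set ι)) (hno : ∀ m : Fin 5, ¬ SuppZeroFlag 4 (fun j => U (m.succAbove j)))
    (hall : ∀ e ∈ S, ∀ b : Bool, SuppZeroFlag 5 (fun j => secAt e b (U j))) (habs : ∀ j, ∃ l, l ≠ j ∧ ¬ U l ⊆ U j) :
    CombPos (fun _ : ι => 5) (fun p => sahiE (bernoulliWeight p) 5 (fun j => ind (U j))) := by
  obtain ⟨hne, h0⟩ := nonempty_and_nonsure_of_noAbsorber U hU hno habs
  obtain ⟨c, hcap⟩ := GluedFrames.principalCap_of_faceVanishing 1 ι U S hU hUS hne h0 hno hall habs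
  exact combPos_sahiE_five_of_principalCap U hU c hcap

/-- **(M⁺-5) and pointwise (EQ-5) for TERMINAL 5-families** (the hypotheses of `TerminalTight 2`). [this work] -/
theorem sahiE_five_ind_eq_zero_iff_of_terminal (p : ι → unitInterval) (hp : ∀ e, (p e : ℝ) ∈ Set.Ioo (0 : ℝ) 1)
    (U : Fin 5 → Set (Set ι)) (S : Finset ι) (hU : ∀ j, IsUpperSet (U j)) (hUS : ∀ j, DeterminedBy (U j) (↑S : Set ι))
    (hno : ∀ m : Fin 5, ¬ SuppZeroFlag 4 (fun j => U (m.succAbove j)))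
    (hall : ∀ e ∈ S, ∀ b : Bool, SuppZeroFlag 5 (fun j => secAt e b (U j))) (habs : ∀ j, ∃ l, l ≠ j ∧ ¬ U l ⊆ U j) :
    sahiE (bernoulliWeight p) 5 (fun j => ind (U j)) = 0 ↔ SuppZeroFlag 5 U :=
  sahiE_ind_eq_zero_iff_of_combPos hU (combPos_sahiE_five_of_faceVanishing_noAbsorber U S hU hUS hno hall habs) hp

/-- **Pointwise (EQ-5) on EVERY face-vanishing 5-family**: five increasing events determined by `S`, all of whose minors at coordinates of `S`
are zero flags, satisfy `E₅(μ_p; 1_U) = 0 ↔ U ∈ Z₅` at every interior `p`. [this work] -/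
theorem sahiE_five_ind_eq_zero_iff_of_faceVanishing (p : ι → unitInterval) (hp : ∀ e, (p e : ℝ) ∈ Set.Ioo (0 : ℝ) 1)
    (U : Fin 5 → Set (Set ι)) (S : Finset ι) (hU : ∀ j, IsUpperSet (U j)) (hUS : ∀ j, DeterminedBy (U j) (↑S : Set ι))
    (hall : ∀ e ∈ S, ∀ b : Bool, SuppZeroFlag 5 (fun j => secAt e b (U j))) :
    sahiE (bernoulliWeight p) 5 (fun j => ind (U j)) = 0 ↔ SuppZeroFlag 5 U := by
  refine ⟨fun hz => ?_, fun hZ => masterFamilyEqIff_mpr 5 ι p U hZ⟩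
  by_cases habs : ∃ j, ∀ l, l ≠ j → U l ⊆ U j
  · obtain ⟨j, hj⟩ := habs
    rw [sahiE_ind_eq_of_absorbing (bernoulliWeight p) (n := 3) U j hj] at hz
    have hfac : (0 : ℝ) < ((3 : ℕ) : ℝ) + 1 - ex (bernoulliWeight p) (ind (U j)) := by
      have h1 := ex_bernoulliWeight_ind_le_one p (U j)
      push_cast
      linarith
    have hE4 : sahiE (bernoulliWeight p) 4 (fun i => ind (U (j.succAbove i))) = 0 := (mul_eq_zero.1 hz).resolve_left hfac.ne'
    have hZ4 : SuppZeroFlag 4 (fun i => U (j.succAbove i)) :=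
      (sahiE_four_ind_eq_zero_iff_of_faceVanishing p hp (fun i => U (j.succAbove i)) S (fun i => hU _) (fun i => hUS _)
        (faceVanishing_erase_of_absorbing U S hU hall j hj)).1 hE4
    exact (suppZeroFlag_iff_erase_of_absorbing U hU j hj).2 hZ4
  · push Not at habs
    by_cases hdel : ∃ m : Fin 5, SuppZeroFlag 4 (fun j => U (m.succAbove j))
    · obtain ⟨m, hm⟩ := hdel
      exact ((masterFamily_step_all p U hU m hm).2 hp).1 hz
    · push Not at hdel
      exact (sahiE_ind_eq_zero_iff_of_combPos hU (combPos_sahiE_five_of_faceVanishing_noAbsorber U S hU hUS hdel hall habs) hp).1 hz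

/-- Strict form: a face-vanishing 5-family outside `Z₅` has `E₅(μ_p) > 0` at every interior `p`. [this work] -/
theorem sahiE_five_ind_pos_of_faceVanishing (p : ι → unitInterval) (hp : ∀ e, (p e : ℝ) ∈ Set.Ioo (0 : ℝ) 1)
    (U : Fin 5 → Set (Set ι)) (S : Finset ι) (hU : ∀ j, IsUpperSet (U j)) (hUS : ∀ j, DeterminedBy (U j) (↑S : Set ι))
    (hall : ∀ e ∈ S, ∀ b : Bool, SuppZeroFlag 5 (fun j => secAt e b (U j))) (hZ : ¬ SuppZeroFlag 5 U) :
    0 < sahiE (bernoulliWeight p) 5 (fun j => ind (U j)) :=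
  lt_of_le_of_ne (sahiE_five_ind_nonneg_of_faceVanishing p U S hU hUS hall) fun h =>
    hZ ((sahiE_five_ind_eq_zero_iff_of_faceVanishing p hp U S hU hUS hall).1 h.symm)

end Pointwise

end Summit.CriticalPhenomena.PercolationContinuityZ3.Theorems
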